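import Summits.ResolutionOfSingularities.ResolutionOfSingularities.Theses.FrobeniusLadder
import Summits.ResolutionOfSingularities.ResolutionOfSingularities.Theorems.FrobeniusLadderFInjectiveMacaulayficationRegularTower
import HarnessLib

/-!
# Crux `FInjectiveMacaulayfication` (stmt-ResolutionOfSingularities-15315) — LINE v43 «TWIN TOWERS» (BY EVIDENCE ONLY; v41 `Lines/step_door.lean` STAYS THE REGISTERED SKELETON)
# (res-L1-w45a-plan-1 RULINGS R19.8 (4) / R19.8a: published by lead-1 BY EVIDENCE after the (RR-K) file `…RegularTower` (res-L1-w45a-lead-1's RR sig, adopted; the desk's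
# parallel sig `L/w45a/SingTowerSig.lean` 0991a6b185eb4b2c stays evidence) is ✓ and READ; text by res-L1-w45a-lead-1 g9 over res-L1-w45a-stub-2's `…IntrinsicTowerRecipes`
# (TT v2) and lead-1's `…RegularTower` (RR), both bridged by lead-1's `…FullCentreDescent` / `…FullCentreDescentRegular`)

[OURS · L1 W4.5a] Line file in skeleton shape (ZERO-binder theorems only; sorries ONLY in the three `stub_*`; the deciding theorem `FInjectiveMacaulayfication_of` (alias
`FInjectiveMacaulayfication_proof`) concludes the route decl BY NAME). NOT registered with `ledger skeleton check`: both tower conjectures are kernel-STRONGER than the halves of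
v41 they imply (R18.7). AI-written (AI review is weaker than expert review).

THE LINE. Door v41's whole non-print residue {F-half (CM ⇒ FULL, fibre-locally, d ≥ 4), T-half T″(p,e,1) (FULL ⇒ REGULAR, fibre-locally, e ≥ 4)} — two ∃-statements no
computation can refute — is replaced by TWO CANONICAL PROCESSES, each refutable by ONE computed tower:
  * (TT-τ) `IntrinsicTower.Recipes.TauTowerConjecture`: from every admissible Cohen–Macaulay first floor, the tower «blow up the reduced closure of the (non-F-regular ∪ non-FULL)
    singular locus, repeat» ends FULL at every point after finitely many floors (⇒ F-half: `…Recipes.localFInjectivizationFibreAdmGe4_of_towerTerminates`, ✓ p632743);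
  * (RR-Sing) `RegTower.SingTowerConjecture p e 1`, e ≥ 4: from every admissible FULL first floor of a FULL `e`-fold germ over `k(s)`, the tower «blow up the reduced closure of
    the singular locus, repeat» ends REGULAR after finitely many floors (⇒ T″(p,e,1): `RegTower.tStep_of_singTowerConjecture`).
Both bridges are ONE call of lead-1's generic descent `FullCentreDescent.exists_centre_of_tower (Q R)` (✓ p632502; FULL resp. regularity as the conclusion, regularity as the
invariant off the closed fibre), i.e. Temkin 2008 Lemma 2.1.4 iterated + uniqueness of blowing ups + stalk transport; the kill shape for either is
`FullCentreDescent.not_exists_tower_of_persistent`.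
EVIDENCE (OURS, evidence level): (TT-τ) rad τ FULL on 21/21 specimens / 98 runs (res-L1-w45a-idea-1 FB5-r4/r5/r6), K-TT test of record res-L1-w45a-tri-2 kit j307835; the N-recipe twin
REFUTED BY EVIDENCE (escalator, R19.7); ⚠ LIVE K-TT-a CANDIDATE AGAINST (TT-τ) ITSELF at publication time: an abstract PERIOD-TWO rad-τ cycle `L ⇄ M` of 4-fold hypersurface
charts over 𝔽₂ (idea-1 g23 FB5-r7, independently replayed by tri-2 g16, 12:58Z) — its OCCURRENCE on an admissible floor (floor 10 of Bl_𝔪 of d4lx6q7 = z²+x⁶z+y³+u³+t⁷) is being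
replayed (tri-2 kit j309057); if confirmed, `stub_tauTowerConjecture` is REFUTED BY EVIDENCE and this line (and v42) die — v41 untouched (kernel receiver for the certificate:
lead-1 ✓ p635381 `FullCentreDescent.not_exists_fullTower_of_recurrent_family₁`, modulo the test-ideal identification on the charts). (RR-Sing) ONE instance: E4″@G (G = {ab + w₁³+w₂³+w₃³}, p = 2) has Sing_red tower height 2 from the point floor — the chain's T″ kernel row
`E4FloorTwoGlue.tStepInstanceAt_G_origin` ✓ p633422 (res-L1-w45a-stub-1; RR-instance file (RR-I) `RegTower.TowerRegular singCentre 2 1 S′` commissioned); K-RR programme R19.8 (5) ((R1) feasibility, (R2) RR table v0 on the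
cured floors, (R3) adversarial FULL germs); nearest negative prior art (tri-2 g16 read): iterated NASH blow-ups fail on a normal toric 4-fold in every characteristic
(Castillo–Duarte–Leyton-Álvarez–Liendo, Ann. Math. 2026) — Nash ≠ Sing_red, not a refutation, but the likely habitat of a kill.
HONEST CAVEATS: both conjectures are CANDIDATES, kernel-stronger than the halves; `tauCentre` is typed over the instance-free `testIdeal'` whose bed values are not identified in the
kernel; reduced-singular-locus blow-ups are classically uncontrolled on general schemes — whether FULL floors tame them is exactly K-RR; the frame is recipe-parametric on both
sides (a Hilbert–Samuel or weighted recipe can replace either centre without touching the bridges); open for every d, e ≥ 4; FULL ⊋ F-rational; nothing of the crux is proved.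
KILL TEST: `stub_tauTowerConjecture` (K-TT-a) and `stub_singTowerConjecture` (K-RR-a) — each kills THIS LINE ONLY (and v42 for the former); K4.5 ALIVE.
-/

-- single-problem summit: the doubled namespace component is forced
set_option linter.dupNamespace false

noncomputable section

namespace Summit.ResolutionOfSingularities.ResolutionOfSingularities.Cruxes.FInjectiveMacaulayfication.TwinTowers

open AlgebraicGeometry CategoryTheory Literature.AlgebraicGeometry.Resolution

/-- NAMED FACTS BY NAME (the ONE named-fact stub, NEVER a prover target; byte-identical to v38–v42): Cossart–Piltant 2019 Thm 1.1 (`CossartPiltant2019General`) ·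
Raynaud–Gruson flattening = Stacks 081R (`Stacks081R`) · Cossart–Piltant 2019 Prop 4.4 (`CossartPiltant2019Principalization`) · Česnavičius 2021 Thm 5.3 reading (B)
(`CesnaviciusBlowupMacaulayficationOffClosed`, Literature p602953). [cite: CossartPiltant2019, Thm. 1.1; Prop. 4.4] [cite: StacksProject, Tag 081R] [cite: Cesnavicius2021, Thm. 5.3] -/
theorem stub_namedFacts :
    Literature.AlgebraicGeometry.Resolution.CossartPiltant2019General.{0} ∧ Literature.AlgebraicGeometry.Resolution.Stacks081R.{0} ∧ Literature.AlgebraicGeometry.Resolution.CossartPiltant2019Principalization.{0} ∧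
      Literature.AlgebraicGeometry.Resolution.CesnaviciusBlowupMacaulayficationOffClosed.{0} := by
  sorry

/-- STUB (TT-τ) — **THE rad-τ INTRINSIC TOWER TERMINATES** (`IntrinsicTower.Recipes.TauTowerConjecture` BY NAME; byte-identical to v42's stub): from every admissible Cohen–Macaulay
first floor of the F-half's binders, SOME height of the `tauCentre` tower ends FULL at every point. KILLABLE (K-TT-a); SUPPORTED by 21/21 specimens; implies the F-half.
[conjecture · OURS · v42/v43 stub] -/
theorem stub_tauTowerConjecture :
    Summit.ResolutionOfSingularities.ResolutionOfSingularities.Theorems.FInjectiveMacaulayfication.IntrinsicTower.Recipes.TauTowerConjecture := by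
  sorry

/-- STUB (RR-Sing) — **THE REDUCED-SINGULAR-LOCUS TOWER REGULARIZES, AT FULL GERMS OF `e`-FOLDS OVER `k(s)`, `e ≥ 4`** (`RegTower.SingTowerConjecture p e 1` BY NAME, res-L1-w45a-lead-1's (RR-K) file
`…RegularTower`, plan-1 R19.8/R19.8a): with T″(p,e,1)'s binders VERBATIM (closed singular FULL point `y` of an integral separated finite-type `e`-fold over
`FractionRing (MvPolynomial (Fin 1) k)`, an admissible blowing up `S′ → Spec 𝒪_{Y,y}` along `I ≠ ⊥`, `supp I ⊆ (Reg)ᶜ`, regular off the closed fibre, FULL at every stalk), SOME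
height of the tower «blow up `singCentre` = the reduced ideal sheaf of the closure of the singular locus, repeat» from `S′` is REGULAR at every point. KILLABLE (K-RR-a) by one FULL
admissible floor whose Sing_red tower provably loops (`FullCentreDescent.not_exists_tower_of_persistent`); ONE kernel-level instance in flight (E4″@G, height 2); implies T″(p,e,1)
(`RegTower.tStep_of_singTowerConjecture`), NOT implied by it. [conjecture · OURS · v43 stub] -/
theorem stub_singTowerConjecture :
    ∀ p e : ℕ, p.Prime → 4 ≤ e →
      Summit.ResolutionOfSingularities.ResolutionOfSingularities.Theorems.FInjectiveMacaulayfication.RegTower.SingTowerConjecture p e 1 := by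
  sorry

/-- **THE DECIDING THEOREM (v43, twin towers)**: the crux `FInjectiveMacaulayfication` BY NAME from the named bundle and the two tower conjectures, by
`RegTower.fInjectiveMacaulayfication_of_prints_of_twinTowers` (= v41's `TrFullStepDoor` term with the F-half supplied by (TT-τ) and the T-half by (RR-Sing)). [OURS assembly; v43] -/
theorem FInjectiveMacaulayfication_of :
    Summit.ResolutionOfSingularities.ResolutionOfSingularities.Theses.FrobeniusLadder.FInjectiveMacaulayfication :=
  Summit.ResolutionOfSingularities.ResolutionOfSingularities.Theorems.FInjectiveMacaulayfication.RegTower.fInjectiveMacaulayfication_of_prints_of_twinTowers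
    stub_namedFacts.1 stub_namedFacts.2.1 stub_namedFacts.2.2.1 stub_namedFacts.2.2.2
    stub_tauTowerConjecture stub_singTowerConjecture

/-- The same deciding term under v38's name convention. [OURS assembly; v43] -/
theorem FInjectiveMacaulayfication_proof :
    Summit.ResolutionOfSingularities.ResolutionOfSingularities.Theses.FrobeniusLadder.FInjectiveMacaulayfication :=
  FInjectiveMacaulayfication_of

end Summit.ResolutionOfSingularities.ResolutionOfSingularities.Cruxes.FInjectiveMacaulayfication.TwinTowers

end
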